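import Mathlib
import HarnessLib
import HarnessLib.Audit
import Summits.NavierStokesRegularity.Statement
import Literature.Analysis.FluidPDE.ClassicalSolution
import Literature.Analysis.FluidPDE.LerayHopf
import Summits.NavierStokesRegularity.NavierStokesRegularity.Theorems.BlowupAssembly
import HarnessLib.Audit.Status.Attr

/-!
Route: AdiabaticEddy

CLOSED (refuted) 2026-08-16T13:35:40Z by planner-rchoice-NavierStokesRegularity-Adiabat-43158e94-0 — reason: refuted:stmt-NavierStokesRegularity-1429 (CorrectorSolvable) by Summit.NavierStokesRegularity.NavierStokesRegularity.Theorems.not_CorrectorSolvable — note: Summit.NavierStokesRegularity.NavierStokesRegularity.Theorems.not_CorrectorSolvable (p103644, Theorems/AdiabaticEddyCorrectorSolvableRefutation.lean @7c31a3b0725b); substantive, sign-free, (a,b,c)-free: the first-order corrector equation of a COMPACTLY SUPPORTED frozen steady-Euler eddy is a Stokes-. The file is kept as the record of this route; refuted decls are indexed as negative knowledge (`ledger negatives`).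

Route AdiabaticEddy — NavierStokesRegularity, NEGATIVE side (realises idea card
adiabatic-eddy-chirality-law: "impulse says swell, anti-superhelicity says shrink").

THESIS X = FrozenEddyCollapse ∧ ClayUniqueness ("it suffices to show X"; X →
¬NavierStokesRegularity).
FrozenEddyCollapse (the card's class (III-c), stated as a blow-up WITNESS): for some ν > 0 there is
a finite-energy classical solution of unforced NS on ℝ³×[0,T), Leray–Hopf from a rapidly decaying
smooth datum, maximal (no classical extension past T), which near T is a FROZEN STEADY EULER EDDY
COLLAPSING AT THE LERAY LENGTH WITH A TYPE-II AMPLITUDE: there are a nonzero smooth compactly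
supported steady Euler flow U (U·∇U + ∇P = 0, div U = 0), an exponent α ∈ (1/2, 3/4), ℓ > 0 and a
centre path ξ(t) with
   (T − t)^α · u(t, ξ(t) + ℓ√(ν(T−t)) y) → U(y)   locally uniformly in y as t ↑ T.
ClayUniqueness = X5b of route Blowup (stmt-NavierStokesRegularity-0153, shared verbatim): a
Clay-class solution (smooth on ℝ³×[0,∞), bounded energy, nothing else) agrees with the finite-energy
classical solution from the same rapidly decaying datum on its interval of existence.
Lean (all decls elaborate, folder Sketch.lean rc 0 on the farm; constants:
Literature.Analysis.FluidPDE.{IsMaximalSmoothSolution, IsLerayHopfOn, HasRapidSpatialDecay,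
IsClassicalNSSolutionOn, VectorCalculus.IsDivFree, convect, curl, helicity, cross,
IsSmoothOnHalfSpace, IsNavierStokesSolution, HasBoundedEnergy}, Mathlib gradient /
Laplacian.laplacian / HasCompactSupport / TendstoLocallyUniformly):
 FrozenEddyCollapse: ∃ ν>0, ∃ T>0, ∃ u p, IsMaximalSmoothSolution ν 0 u p T ∧ IsLerayHopfOn T ν 0 (u
0) u ∧ HasRapidSpatialDecay (u 0) ∧ ∃ U P, ContDiff ℝ ⊤ U ∧ ContDiff ℝ ⊤ P ∧ HasCompactSupport U ∧ U
≠ 0 ∧ IsDivFree U ∧ (∀ x, convect U U x + gradient P x = 0) ∧ ∃ α ∈ Ioo (1/2) (3/4), ∃ ℓ>0, ∃ ξ,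
TendstoLocallyUniformly (fun t y => (T−t)^α • u t (ξ t + (ℓ√(ν(T−t))) • y)) U (𝓝[<] T)
 Assembly: FrozenEddyCollapse → ClayUniqueness → ¬NavierStokesRegularity — PROVED in Sketch.lean
(theorem assembly_holds, axioms propext/Classical.choice/Quot.sound) by projecting
FrozenEddyCollapse to X5a and applying the accepted glue Literature.NS.blowup_assembly (stmt-0151).

WHY X (the mechanism, card (I)–(III)): along the exact two-parameter family A·U(x/L) of a steady
Euler eddy, NS fixes the slow drift of (A, L) at order 1/Re through the balances it evolves exactly:
E = eA²L³ (Ė = −ν d_E A²L), helicity H = hA²L² (Ḣ = −ν d_H A², d_H = 2∫curl U·curl curl U = Hide's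
superhelicity), impulse and angular impulse conserved. With D = d_E/e and η = d_H/h: L̇ = ν(η −
D)/L, Ȧ/A = −(ν/L²)(3η/2 − D). Collapse needs η < D; along a collapse L² = 2|η − D|ν(T − t) (LERAY
LENGTH) and |u| ~ A ~ (T−t)^{−α}, α = (D − 3η/2)/(2(D − η)). 0 < η < D gives α < 1/2
(Serrin-regular: fake collapse); η = 0 gives the exactly self-similar case killed by
Nečas–Růžička–Šverák/Tsai/Chae2007; η < 0 (ANTI-SUPERHELICAL: viscosity raises |H|/E, a frozen shape
must shrink) gives α ∈ (1/2, 3/4): Type II, energy of the eddy → 0, dissipation integrable, ‖u‖_{L³}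
~ AL → ∞, ∫‖u‖_∞dt < ∞ — consistent with every catalogued necessary condition and excluded by
nothing in print. For compactly supported U the impulse ∫U vanishes identically and angular momentum
∫y×U = 0 is forced at first order, so the card's vetoes (I)–(II) select the class rather than
obstruct it.

Rationale: WHY THIS LINE. Route Blowup (rev 3) leaves "which scenario" for X5a explicitly NOT decomposed and
route TypeILiouville's rank-2 crux NoTypeII has no named Type-II class to shoot at;
CertifiedBlowup/DssFarFieldSlaving cover self-similar and DSS profiles (Leray amplitude). This route
files the one remaining corner the card isolates: a QUASI-STEADY core — the amplitude-renormalised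
zoom at the singular point converges to a STEADY Euler flow U (the objects gluing methods glue,
DavilaEtAl-type inner solutions; compactly supported ones exist: Gavrilov arXiv:1810.08020,
Constantin–La–Vicol arXiv:1903.11699) — drifting adiabatically along its scaling family at the Leray
length with anomalous amplitude exponent α ∈ (1/2,3/4) fixed by two quadratures of U (energy ratio
D, superhelicity ratio η < 0). Imported areas: invariant-controlled decay bookkeeping of turbulence
theory (Saffman/Loitsyansky invariants, selective decay, Hide's superhelicity
doi:10.1080/03091928908219526) × modulation along equilibrium families (Gallay–Wayne
arXiv:math/0402449 is the rigorous 2-D expanding instance; Beck–Wayne arXiv:1108.3416, Gallay–Šverák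
arXiv:2301.01092 shadow Euler-equilibrium manifolds under NS) × Type-II modulation numerology
(Dávila–del Pino–Wei arXiv:1702.05801). The printed frame in which the class lives is Seregin's
Euler-scaling programme for Type II (doi:10.3934/cpaa.2023108 = arXiv:2304.04045; arXiv:2606.29468
read pp.1–14: zoom v^λ = λf(λ)v(λy, λ²f(λ)τ), f = r^{1−m}, limits are local-energy Euler solutions,
exclusion ⇔ Liouville theorems for Euler in weighted classes); with |u| ~ (T−t)^{−α} on L ~ √(T−t)
his A_f, E_f stay bounded iff m ≤ 3 − 4α ∈ (0,1) — exactly the card's window (refuter audit-11's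
computation, re-derived in NOTES.md).
PLANNER'S SHARPENING OF THE CARD (recorded so refuters grade the route, not the card's slips). (i)
For compactly supported (or Schwartz) div-free U the impulse ½∫y×curl U = ∫U vanishes identically,
so veto (I) never bites in this class; angular momentum j = ∫y×U is the first live moment and j = 0
is FORCED by the first-order solvability below (pairing with y×e_i). (ii) The bare moment conditions
of card-A3 (j = 0, h ≠ 0, η < 0) are cheap: four disjoint copies of one compactly supported steady
flow G with h(G)·d_H(G) ≠ 0 (G and its π-rotated copy cancel j keeping chirality; a mirrored pair at
scale ℓ and amplitude B with B < 1 < Bℓ flips the sign of η) — so A3 is filed as SUPPORT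
(ChiralEddyExists), and the same example shows the naive (A,L)-law is self-inconsistent for
dynamically disconnected U (each blob drifts on its own): the cokernel obstruction the card lists
under "why it might fail" is real and is made the rank-2 crux. (iii) The correct first-order object:
with ε = ν/(AL) = 1/Re, u = A[U + εW](y), p = A²[P + εq](y), y = (x−ξ)/L, the O(Aν/L²) terms give
the CORRECTOR EQUATION (★) U·∇W + W·∇U + ∇q = ΔU − aU + b(y·∇)U + (c·∇)U with a = (L²/ν)Ȧ/A, b =
LL̇/ν, c = Lξ̇/ν. Pairing (★) with the cokernel elements U and curl U returns exactly the card's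
laws (2a + 3b = −D, 2a + 2b = −η, using ∫curl U·(y·∇)U = −h); collapse is b < 0, genuine Type II (α
= a/(2|b|) > 1/2) is a + b > 0 ⇔ η < 0, and α < 3/4 is automatic. But the cokernel of steady
linearised Euler also contains f(B)U and g(B)curl U for every function of the Bernoulli head B
(U×curl U = ∇B): (★) demands ENERGY AND HELICITY BALANCE ON EVERY BERNOULLI TORUS, i.e. U must be a
self-similarly COLLAPSING profile of the two-profile flux-surface-averaged viscous drift (the
Grad–Hogan-type 1.5-D system of card euler-equilibria-tokamak-quasistatics, which treats the
expanding/regular branch in the axisymmetric class). Card arXiv ids corrected: Gavrilov =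
arXiv:1810.08020, CLV = arXiv:1903.11699, Chae–Constantin (Beltrami Liouville) = arXiv:1407.7303.
TWO-LAYER PLAN (D-0019). Layer 1 = the items filed now; layer 2 (glued splits, only after a crux
closes): FrozenEddyCollapse ⇐ [CorrectorSolvable-type profile with all-order expansion] + [normal
hyperbolicity of the collapsing family for the Leray-rescaled linearisation modulo symmetries] +
[inner–outer gluing and Schwartz truncation]; NoFrozenEddyCollapse ⇐ [rigidity: per-torus balance
impossible for b < 0 < a + b in the integrable class] + [compactness: locally uniform convergence at
these rates forces (★) in the limit].
RANKED CRUXES. #2 CorrectorSolvable (Euler-side, LINEAR, typed): some nonzero smooth compactly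
supported steady Euler U admits smooth div-free W, q and constants b < 0 < a + b, c solving (★).
Most informative per unit effort: it decides whether class (III-c) is empty already at first order;
numerically checkable per candidate U (Gavrilov/CLV tori: quadratures + a linear solve),
analytically attackable torus by torus (Constantin–Drivas–Ginsberg arXiv:2007.09103
flexibility/rigidity toolbox; helicity the only integral Casimir, arXiv:1602.04745). Why it might
fail: infinitely many per-Bernoulli-surface conditions against 5 constants; a collapsing
self-similar profile of an averaged DIFFUSION is implausible (the 2-D analogue forces the Oseen
Gaussian, b > 0). #3 FrozenEddyCollapse (the witness; hardest): why it might fail — #2 false, or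
true but the family normally unstable on the turnover scale (Hill/Moffatt–Moore-type instability),
or (III-c) excluded outright by a local-energy-flux/Seregin-type argument. #4 NoFrozenEddyCollapse
(the KILL, positive reading, typed as the universal statement, slightly stronger than ¬#3: no
maximality assumed): why it might fail — #2 ∧ hyperbolicity would make #3 constructible by DdPW-type
gluing. SUPPORT: ClayUniqueness (= stmt-0153, shared; closes via stmt-0728 once Tao's unconditional
uniqueness is vendored); ChiralEddyExists (moment conditions j = 0, h ≠ 0, η·h-sign < 0 for a
compactly supported steady Euler flow; needs Gavrilov/CLV existence, not in tree, plus the four-blob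
trick or a single counter-twisted torus). TARGET AdiabaticEddyThesis = FrozenEddyCollapse ∧
ClayUniqueness; ASSEMBLY proved in sketch.
KILL CRITERIA. NoFrozenEddyCollapse proved ⇒ #3 refuted ⇒ close `refuted:FrozenEddyCollapse` with
the census "quasi-steady Leray-length Type II excluded" handed to TypeILiouville/NoTypeII as a named
settled sub-case (the route's positive payoff). ¬CorrectorSolvable proved in full generality ⇒ the
frozen-eddy class is empty at first order: restate #3 with a DEFORMING profile (drift inside the
equilibrium manifold; merge with the tokamak card's negative exit) or close `exhausted`. NoBlowup
(stmt-0054) proved ⇒ moot. X5b refuted with no replacement selection principle ⇒ as for Blowup.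
NOT DECOMPOSED. Normal hyperbolicity/stability of 3-D Euler equilibrium families (no typed notion
yet; definition request deferred until #2 has a candidate U); the gluing/truncation step; the
necessary-condition theorem "any frozen-eddy collapse has j(U) = 0, h(U) ≠ 0, η(U) < 0 and α = (D −
3η/2)/(2(D − η))" (needs convergence strong enough to localise the E/H balances — provers may file
it with --supports FrozenEddyCollapse); class (IV) (h = 0) and time-dependent Euler tangent flows
(other cards: euler-window-viscous-transfer, landau-tail-impulse-type-ii,
threshold-marginal-blowup-dichotomy).
NUMBERS. Scalings E = eA²L³, H = hA²L², ∫|∇u|² = d_E A²L, 2∫ω·curl ω = d_H A²; L̇ = ν(η−D)/L; α(D,η)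
= (D − 3η/2)/(2(D−η)) ↑ 3/4 as η → −∞, = 1/2 at η = 0; eddy energy ~ (T−t)^{3/2−2α} → 0; dissipation
~ (T−t)^{1/2−2α} integrable iff α < 3/4; ‖u‖³_{L³} ~ (T−t)^{3/2−3α} → ∞; Re(t) = AL/ν ~
(T−t)^{1/2−α} → ∞ (adiabaticity improves); Seregin window m ≤ 3 − 4α. Beltrami check: curl U = λU ⇒
η = D = 2λ², L̇ = 0, Ȧ/A = −νλ² (exact decay). Items at open: 7 (3 cruxes, 2 support, target,
assembly). Searches and derivations: NOTES.md of unit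
plancard-NavierStokesRegularity-Navie-fc921ca4.

Novelty: NOVELTY (searched 2026-08-15, this session: zbMATH "Seregin type II blowup Navier-Stokes Euler
scaling" → arXiv:2606.29468 (read pp.1–14: Euler-scaling zoom, Thm 2.1/3.1, conditional Liouville
frame) and doi:10.3934/cpaa.2023108 = arXiv:2304.04045; zbMATH "superhelicity" → Hide 1989
doi:10.1080/03091928908219526, Galanti–Tsinober doi:10.1016/j.physleta.2005.11.066 (superhelicity as
the helicity-dissipation density — turbulence diagnostics, no blow-up use); zbMATH
Constantin–Drivas–Ginsberg arXiv:2007.09103 (flexibility/rigidity of steady states: the linearised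
steady Euler solvability toolbox, no viscous drift); zbMATH Gavrilov arXiv:1810.08020,
Constantin–La–Vicol arXiv:1903.11699, Chae–Constantin arXiv:1407.7303, Enciso–Peralta-Salas–Torres
de Lizaur arXiv:1602.04745; crossref "quasi-steady blow-up Navier-Stokes steady Euler equilibrium
viscous collapse" (15 rows, all steady-NS numerics/noise); `lit frontier NavierStokesRegularity
--since 2022` (30 rows: forward self-similar, non-uniqueness, ε-regularity — nothing
quasi-steady/Type-II-modulated); galaxy pdf "superhelicity" (biology noise); arXiv API rate-limited
(429), local searchd unavailable (D-0023) — logged in NOTES.md; plus the card's two refuter audits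
(novelty-audit-8/11: zbMATH sweeps on selective decay / final period / Loitsyansky / metastability /
Gavrilov stability, Seregin ×4 read).
Nearest prior art: (a) Gallay–Wayne arXiv:math/0402449 (CMP 255, 2005) — the rigorous adiabatic
drift along an equilibrium scaling  [refs: 10.3934/cpaa.2023108, 10.1080/03091928908219526, 10.1016/j.physleta.2005.11.066, 10.1017/S0022112000008995, 2606.29468, 2304.04045, 2007.09103, 1810.08020, 1903.11699, 1407.7303, 1602.04745, math/0402449, 1108.3416, 2301.01092, 1702.05801, doi:10.3934/cpaa.2023108, doi:10.1080/03091928908219526, doi:10.1016/j.physleta.2005.11.066, doi:10.1017/S0022112000008995, NecasRuzickaSverak1996, Chae2007]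

Barriers (technique_class: blowup-construction quasi-steady-modulation type-II-scenario): BARRIERS (catalogue Literature/Barriers/NavierStokesRegularity read: 18 technique_class entries;
technique_class of this route: blowup-construction quasi-steady-modulation type-II-scenario
steady-euler-profile).
- Literature.Barriers.NavierStokesRegularity.LeraySelfSimilarBlowupExclusion: APPLIES to the η = 0
sub-case only and is USED as a kill: (III-b) is Leray's exact backward self-similar ansatz
(necas_ruzicka_sverak, tsai_selfsimilar) and the asymptotically self-similar variant (Chae2007,
evasions_known) — both have the Leray AMPLITUDE (T−t)^{−1/2}; the route's class (III-c) has
amplitude exponent α > 1/2, i.e. in Leray similarity variables the profile norm grows like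
(T−t)^{1/2−α} and converges to nothing, so neither the formal conjuncts nor Chae's convergence
hypothesis are met (evasion = "non-self-similar (Type II) profiles" listed in evasions_known).
- Literature.Barriers.NavierStokesRegularity.CriticalNormBlowupNecessity: APPLIES to any witness of
FrozenEddyCollapse and is SATISFIED, not evaded: ‖u(t)‖_{L³}³ ≳ A³L³‖U‖³_{L³} ~ (T−t)^{3/2−3α} → ∞
because α > 1/2 (ess_endpoint / seregin_L3_blowup / tao_L3_blowup_rate consistent); sub-case (III-a)
(α < 1/2, L³-bounded, even Serrin-integrable) is exactly what the barrier kills and the route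
discards it as a fake collapse.
- Literature.Barriers.NavierStokesRegularity.SingularSetDimensionBound: APPLIES and is satisfied:
the witness has a single singular point (ξ(T), T) (energy of the eddy → 0, far field regular), a
𝒫¹-null

Novelty grade: new-combination — SECOND ROUTE REVIEW + grade (refuter 116ebd40, 2026-08-15; concurs with ab1e3435's new-combination and ADDS a live-literature pass — zbMATH/Crossref reachable this session, local searchd/OpenAlex/arXiv/S2 still down or 429). Queries: zbMATH 'Gavrilov compactly supported Euler' (4 rows → NEW: Peralta (refuter refuter-rreview-route-NavierStokesRegula-116ebd40-0, 2026-08-15T12:14:51Z; prior: Gavrilov arXiv:1810.08020, Constantin–La–Vicol arXiv:1903.11699, Peralta-Salas–Slobodeanu arXiv:2606.13462 (2026, Thm 1.1: analytic localizable steady Euler flows are axisymmetric), Gallay–Wayne arXiv:math/0402449, Gallay–Šverák arXiv:2301.01092 (Invent. Math. 2024), Dávila–del Pino–Wei arXiv:1702.05801, Seregin arXiv:2304.04045 = doi:10.3934/cpaa.2023108, Seregin arXiv:2606.29468, Hide 1989 doi:1)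

History (route lifecycle, newest last):
- 2026-08-15T16:14:31Z · rev 2: restated ChiralEddyExists (stmt-NavierStokesRegularity-1432), Assembly (stmt-NavierStokesRegularity-1428) — route-repair (glue + import diet): (1) deciding theorem `closes : FrozenEddyCollapse → ClayUniqueness → ¬NavierStokesRegularity` (refutation side; self-containe (planner-rbadge-NavierStokesRegularity-Adiabati-d664fed4-g2-0)
- 2026-08-15T16:16:05Z · rev 3: restated Assembly (stmt-NavierStokesRegularity-10398) — route-repair follow-up (import diet): restate Assembly once more (cosmetic: `¬ _root_.NavierStokesRegularity`, the literal conclusion of `closes`) solely to she (planner-rbadge-NavierStokesRegularity-Adiabati-d664fed4-g2-0)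
- 2026-08-16T13:10:59Z · BROKEN — CorrectorSolvable (stmt-NavierStokesRegularity-1429, crux) refuted by Summit.NavierStokesRegularity.NavierStokesRegularity.Theorems.not_CorrectorSolvable @ 7c31a3b0725b (prover-line-stmt-NavierStokesRegularity-1429-0)
- 2026-08-16T13:35:40Z · CLOSED refuted — refuted:stmt-NavierStokesRegularity-1429 (CorrectorSolvable) by Summit.NavierStokesRegularity.NavierStokesRegularity.Theorems.not_CorrectorSolvable (planner-rchoice-NavierStokesRegularity-Adiabat-43158e94-0)

sub-problem: NavierStokesRegularity · status: closed(refuted) · opened planner-plancard-NavierStokesRegularity-Navie-fc921ca4-0 2026-08-15T10:56:04Z · rev 3 · ledger route-NavierStokesRegularity-AdiabaticEddy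
GENERATED by the gate from the ledger (D-0016/17). Provers cite these decls: `theorem foo : Summit.NavierStokesRegularity.NavierStokesRegularity.Theses.AdiabaticEddy.<Decl> := …` in Summits/NavierStokesRegularity/NavierStokesRegularity/Theorems/<Name>.lean.
-/

namespace Summit.NavierStokesRegularity.NavierStokesRegularity.Theses.AdiabaticEddy

open scoped BigOperators Topology Manifold Classical MeasureTheory ProbabilityTheory Matrix InnerProductSpace ComplexConjugate ContinuousMap
open Filter Set Function TopologicalSpace MeasureTheory

attribute [summit_statement] _root_.NavierStokesRegularity

open Literature.NS

/-- item stmt-NavierStokesRegularity-1427 · target · rank 0 · closed · moot by None · by planner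
why it might fail: Class (III-c) may be empty: CorrectorSolvable false (per-Bernoulli-torus balances over-determine frozen-shape drift), or normally unstable, or excluded by a local-energy-flux/Seregin-type argument (NoFrozenEddyCollapse).
sources: Fefferman2000, arXiv:1702.05801, arXiv:2304.04045, arXiv:2606.29468, arXiv:1810.08020
[target] X = FrozenEddyCollapse ∧ ClayUniqueness. FrozenEddyCollapse (card class (III-c) as a
WITNESS): for some ν>0 a finite-energy classical NS solution from a rapidly decaying smooth datum is
maximal with finite lifespan T and, renormalised at the LERAY LENGTH ℓ√(ν(T−t)) around a centre path
ξ(t) with a TYPE-II amplitude (T−t)^{−α}, α ∈ (1/2,3/4), converges locally uniformly to a nonzero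
smooth compactly supported steady Euler flow U (frozen eddy). ClayUniqueness = X5b
(stmt-NavierStokesRegularity-0153, shared with Blowup/CertifiedBlowup/DssFarFieldSlaving). The
card's bookkeeping predicts α = (D − 3η/2)/(2(D − η)) with D = ∫|∇U|²/(½∫|U|²)-ratio and η = 2∫curl
U·curl curl U / ∫U·curl U < 0 (anti-superhelical), ℓ² = 2|η − D|. [sources: Fefferman2000,
arXiv:1702.05801, arXiv:2304.04045, arXiv:2606.29468, arXiv:1810.08020, arXiv:1903.11699] -/
@[route_item "route-NavierStokesRegularity-AdiabaticEddy"]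
def AdiabaticEddyThesis : Prop :=
  (∃ ν : ℝ, 0 < ν ∧ ∃ T : ℝ, 0 < T ∧ ∃ (u : ℝ → EuclideanSpace ℝ (Fin 3) → EuclideanSpace ℝ (Fin 3)) (p : ℝ → EuclideanSpace ℝ (Fin 3) → ℝ), Literature.Analysis.FluidPDE.IsMaximalSmoothSolution ν 0 u p T ∧ Literature.Analysis.FluidPDE.IsLerayHopfOn T ν 0 (u 0) u ∧ Literature.Analysis.FluidPDE.HasRapidSpatialDecay (u 0) ∧ ∃ (U : EuclideanSpace ℝ (Fin 3) → EuclideanSpace ℝ (Fin 3)) (P : EuclideanSpace ℝ (Fin 3) → ℝ), ContDiff ℝ (⊤ : ℕ∞) U ∧ ContDiff ℝ (⊤ : ℕ∞) P ∧ HasCompactSupport U ∧ U ≠ 0 ∧ Literature.Analysis.FluidPDE.VectorCalculus.IsDivFree U ∧ (∀ x, Literature.Analysis.FluidPDE.convect U U x + gradient P x = 0) ∧ ∃ α ∈ Set.Ioo (1 / 2 : ℝ) (3 / 4), ∃ ℓ : ℝ, 0 < ℓ ∧ ∃ ξ : ℝ → EuclideanSpace ℝ (Fin 3), TendstoLocallyUniformly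 (fun (t : ℝ) (y : EuclideanSpace ℝ (Fin 3)) => ((T - t) ^ α) • u t (ξ t + (ℓ * Real.sqrt (ν * (T - t))) • y)) U (nhdsWithin T (Set.Iio T))) ∧ (∀ ν : ℝ, 0 < ν → ∀ (u₀ : EuclideanSpace ℝ (Fin 3) → EuclideanSpace ℝ (Fin 3)), Literature.Analysis.FluidPDE.HasRapidSpatialDecay u₀ → ∀ (u v : ℝ → EuclideanSpace ℝ (Fin 3) → EuclideanSpace ℝ (Fin 3)) (p q : ℝ → EuclideanSpace ℝ (Fin 3) → ℝ) (T : ℝ), 0 < T → Literature.Analysis.FluidPDE.IsSmoothOnHalfSpace u → Literature.Analysis.FluidPDE.IsSmoothOnHalfSpace p → Literature.Analysis.FluidPDE.IsNavierStokesSolution ν 0 u₀ u p → Literature.Analysis.FluidPDE.HasBoundedEnergy u → Literature.Analysis.FluidPDE.IsClassicalNSSolutionOn (Set.Ico 0 T) ν 0 v q → Literature.Analysis.FluidPDE.IsLerayHopfOn T ν 0 u₀ v → v 0 = u₀ → ∀ t ∈ Set.Ico 0 T, u t = v t)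

/-- item stmt-NavierStokesRegularity-1429 · crux · rank 2 · closed · refuted by Summit.NavierStokesRegularity.NavierStokesRegularity.Theorems.not_CorrectorSolvable @ 7c31a3b0725b (prover) · by planner
why it might fail: Per-Bernoulli-torus energy+helicity balances (cokernel f(B)U, g(B)curl U) are infinitely many conditions on 5 constants; a self-similarly COLLAPSING profile of an averaged diffusion is implausible (2-D analogue forces the expanding Oseen Gaussian, b>0).
sources: arXiv:1810.08020, arXiv:1903.11699, arXiv:2007.09103, arXiv:1602.04745, arXiv:math/0402449
[crux] FIRST-ORDER SOLVABILITY OF FROZEN-EDDY COLLAPSE (Euler-side, linear). Ansatz u = A(t)[U +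
εW]((x−ξ)/L(t)), p = A²[P + εq], ε = ν/(AL) = 1/Re, U smooth compactly supported steady Euler (U·∇U
+ ∇P = 0, div U = 0). The O(Aν/L²) terms of NS give the CORRECTOR EQUATION (★) U·∇W + W·∇U + ∇q = ΔU
− aU + b(y·∇)U + (c·∇)U with constants a = (L²/ν)Ȧ/A, b = LL̇/ν, c = Lξ̇/ν (Lean: convect U W y +
convect W U y + gradient q y = Laplacian.laplacian U y − a•U y + b•(fderiv ℝ U y) y + (fderiv ℝ U y)
c). Pairing (★) with the cokernel elements U and curl U of steady linearised Euler gives the card's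
adiabatic laws 2a + 3b = −D, 2a + 2b = −η (D = ∫|∇U|²/½∫|U|², η = 2∫curl U·curl curl U/∫U·curl U;
uses ∫curl U·(y·∇)U = −∫U·curl U); pairing with y×e_i forces ∫y×U = 0 (angular momentum); impulse ∫U
≡ 0 automatically. COLLAPSE is b < 0 (L² = 2|b|ν(T−t): Leray length), GENUINE TYPE II is a + b > 0
(amplitude exponent α = a/(2|b|) > 1/2 ⇔ η < 0, anti-superhelical; α < 3/4 automatic). The statement
asks for ONE nonzero compactly supported steady U (Gavrilov arXiv:1810.08020 / Constantin–La–Vicol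
arXiv:1903.11699 tori and their finite disjoint unions are the known supply) for which (★) has a
smooth d -/
@[route_item "route-NavierStokesRegularity-AdiabaticEddy"]
def CorrectorSolvable : Prop :=
  ∃ (U W : EuclideanSpace ℝ (Fin 3) → EuclideanSpace ℝ (Fin 3)) (P q : EuclideanSpace ℝ (Fin 3) → ℝ) (a b : ℝ) (c : EuclideanSpace ℝ (Fin 3)), ContDiff ℝ (⊤ : ℕ∞) U ∧ ContDiff ℝ (⊤ : ℕ∞) P ∧ HasCompactSupport U ∧ U ≠ 0 ∧ Literature.Analysis.FluidPDE.VectorCalculus.IsDivFree U ∧ (∀ x, Literature.Analysis.FluidPDE.convect U U x + gradient P x = 0) ∧ ContDiff ℝ (⊤ : ℕ∞) W ∧ ContDiff ℝ (⊤ : ℕ∞) q ∧ Literature.Analysis.FluidPDE.VectorCalculus.IsDivFree W ∧ b < 0 ∧ 0 < a + b ∧ ∀ y, Literature.Analysis.FluidPDE.convect U W y + Literature.Analysis.FluidPDE.convect W U y + gradient q y = Laplacian.laplacian U y - a • U y + b • (fderiv ℝ U y) y + (fderiv ℝ U y) c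

/-- item stmt-NavierStokesRegularity-1430 · crux · rank 3 · closed · moot by None · by planner
why it might fail: CorrectorSolvable may be false (no frozen profile at first order); 3-D Euler equilibrium families are typically normally UNSTABLE on the turnover scale (Hill/Moffatt–Moore); or (III-c) is excluded by a local-energy-flux / Euler-scaling Liouville argument.
sources: arXiv:1702.05801, arXiv:2304.04045, arXiv:2606.29468, Chae2007, NecasRuzickaSverak1996, Seregin2012
[crux] THE WITNESS (card thesis B2, first branch): ∃ ν>0, T>0 and a classical solution (u,p) of
unforced NS on ℝ³×[0,T), Leray–Hopf from a rapidly decaying datum, with NO classical extension past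
T (IsMaximalSmoothSolution: this conjunct alone is X5a = Blowup crux #2,
stmt-NavierStokesRegularity-0152), and a nonzero smooth compactly supported steady Euler flow U, α ∈
(1/2,3/4), ℓ > 0, ξ : ℝ → ℝ³ with (T−t)^α · u(t, ξ(t) + ℓ√(ν(T−t)) y) → U(y) locally uniformly in y
as t ↑ T (TendstoLocallyUniformly … (𝓝[<] T)). Consequences (not conjuncts): ‖u(t)‖_∞ ≳ (T−t)^{−α}
so the blow-up is Type II (¬IsTypeIBlowup), ‖u‖_{L³} → ∞ (consistent with ESS/Seregin2012), eddy
energy ~ (T−t)^{3/2−2α} → 0, ∫‖u‖_∞ dt < ∞. Intended mechanism (card A2, 'adiabatic theorem'): a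
CorrectorSolvable profile U (rank-2 crux) whose collapsing family is normally hyperbolic for the
Leray-rescaled NS linearisation modulo symmetries; shadowing for O(Re) turnover times improves to
shadowing up to T because Re(t) = AL/ν ~ (T−t)^{1/2−α} → ∞ along the collapse; inner–outer gluing
and Schwartz truncation à la Dávila–del Pino–Wei arXiv:1702.05801 / Merle–Raphaël-type modulation.
Predicted constants: α = (D − 3η/2)/(2(D − η) -/
@[route_item "route-NavierStokesRegularity-AdiabaticEddy", crux]
def FrozenEddyCollapse : Prop :=
  ∃ ν : ℝ, 0 < ν ∧ ∃ T : ℝ, 0 < T ∧ ∃ (u : ℝ → EuclideanSpace ℝ (Fin 3) → EuclideanSpace ℝ (Fin 3)) (p : ℝ → EuclideanSpace ℝ (Fin 3) → ℝ), Literature.Analysis.FluidPDE.IsMaximalSmoothSolution ν 0 u p T ∧ Literature.Analysis.FluidPDE.IsLerayHopfOn T ν 0 (u 0) u ∧ Literature.Analysis.FluidPDE.HasRapidSpatialDecay (u 0) ∧ ∃ (U : EuclideanSpace ℝ (Fin 3) → EuclideanSpace ℝ (Fin 3)) (P : EuclideanSpace ℝ (Fin 3) → ℝ), ContDiff ℝ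 (⊤ : ℕ∞) U ∧ ContDiff ℝ (⊤ : ℕ∞) P ∧ HasCompactSupport U ∧ U ≠ 0 ∧ Literature.Analysis.FluidPDE.VectorCalculus.IsDivFree U ∧ (∀ x, Literature.Analysis.FluidPDE.convect U U x + gradient P x = 0) ∧ ∃ α ∈ Set.Ioo (1 / 2 : ℝ) (3 / 4), ∃ ℓ : ℝ, 0 < ℓ ∧ ∃ ξ : ℝ → EuclideanSpace ℝ (Fin 3), TendstoLocallyUniformly (fun (t : ℝ) (y : EuclideanSpace ℝ (Fin 3)) => ((T - t) ^ α) • u t (ξ t + (ℓ * Real.sqrt (ν * (T - t))) • y)) U (nhdsWithin T (Set.Iio T))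

/-- item stmt-NavierStokesRegularity-1431 · crux · rank 4 · closed · moot by None · by planner
why it might fail: FrozenEddyCollapse may be TRUE: a CorrectorSolvable anti-superhelical torus with a normally hyperbolic collapsing family would make the witness constructible by DdPW-type gluing (arXiv:1702.05801); locally uniform convergence may also be too weak to localise E/H balances.
sources: arXiv:2304.04045, arXiv:2606.29468, Chae2007, EscauriazaSereginSverak2003, Seregin2012, arXiv:1702.05801
[crux] THE KILL (card A4 / thesis B1, positive reading; filed as the universal statement, slightly
STRONGER than ¬FrozenEddyCollapse since no maximality is assumed — the implication
NoFrozenEddyCollapse → ¬FrozenEddyCollapse is formal and checked in Sketch.lean): for every ν>0,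
T>0, every classical NS solution on ℝ³×[0,T) that is Leray–Hopf from a rapidly decaying datum, every
smooth compactly supported steady Euler flow U, every α ∈ (1/2,3/4), ℓ>0 and centre path ξ: if
(T−t)^α u(t, ξ(t) + ℓ√(ν(T−t)) y) → U(y) locally uniformly as t ↑ T then U = 0. No theorem in print
covers it: NRŠ/Tsai/Chae2007 need the Leray amplitude (α = 1/2), ESS/Seregin2012 are consistent with
it, KNSS Liouville is Type I. Candidate engines: (a) pass to the limit in the renormalised equation:
locally uniform convergence at these rates makes U steady Euler (consistent) and the next order
imposes the corrector equation (★) of CorrectorSolvable with b = −ℓ²/2·(…) < 0 < a + b — so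
¬CorrectorSolvable (in the needed generality) plus a compactness step proves this item; (b) local
energy inequality across the neck |x − ξ| ~ √(T−t): the eddy's energy eA²L³ → 0 while its L³ norm
diverges forces an outward energy flux -/
@[route_item "route-NavierStokesRegularity-AdiabaticEddy", crux]
def NoFrozenEddyCollapse : Prop :=
  ∀ ν : ℝ, 0 < ν → ∀ T : ℝ, 0 < T → ∀ (u : ℝ → EuclideanSpace ℝ (Fin 3) → EuclideanSpace ℝ (Fin 3)) (p : ℝ → EuclideanSpace ℝ (Fin 3) → ℝ), Literature.Analysis.FluidPDE.IsClassicalNSSolutionOn (Set.Ico 0 T) ν 0 u p → Literature.Analysis.FluidPDE.IsLerayHopfOn T ν 0 (u 0) u → Literature.Analysis.FluidPDE.HasRapidSpatialDecay (u 0) → ∀ (U : EuclideanSpace ℝ (Fin 3) → EuclideanSpace ℝ (Fin 3)) (P : EuclideanSpace ℝ (Fin 3) → ℝ), ContDiff ℝ (⊤ : ℕ∞) U → ContDiff ℝ (⊤ : ℕ∞) P → HasCompactSupport U → Literature.Analysis.FluidPDE.VectorCalculus.IsDivFree U → (∀ x, Literature.Analysis.FluidPDE.convect U U x + gradient P x =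 0) → ∀ α ∈ Set.Ioo (1 / 2 : ℝ) (3 / 4), ∀ ℓ : ℝ, 0 < ℓ → ∀ ξ : ℝ → EuclideanSpace ℝ (Fin 3), (TendstoLocallyUniformly (fun (t : ℝ) (y : EuclideanSpace ℝ (Fin 3)) => ((T - t) ^ α) • u t (ξ t + (ℓ * Real.sqrt (ν * (T - t))) • y)) U (nhdsWithin T (Set.Iio T))) → U = 0

/-- item stmt-NavierStokesRegularity-0153 · support · rank 5 · closed · proved by Summit.NavierStokesRegularity.NavierStokesRegularity.Theorems.adiabaticEddy_clayUniqueness_proof @ 47141fc88209 (prover) · by planner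
sources: Fefferman2000, Tao2011, Prodi1959, Serrin1963
Fefferman's class (A) = jointly C^∞ on ℝ³×[0,∞) + sup_t ∫|u|² < ∞; no energy inequality, no decay of
∇u, no integrability in LPS scales is assumed. Claim: such (u,p) coincides on [0,T) with any
Leray–Hopf classical solution v from the same rapidly decaying datum. Expected route: smoothness +
bounded energy ⇒ u is a distributional solution with locally finite dissipation?? (NOT automatic:
∫∫|∇u|² may be infinite) — this is exactly the delicate point; alternatives: Liouville-type control
of the pressure (p harmonic part must be affine ⇒ excluded by bounded energy), then local energy
inequality, then weak–strong uniqueness (Prodi 1959, Serrin 1963) against v which is in every LPS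
class on compacts of [0,T). [sources: Prodi1959, Serrin1963, Fefferman2000, LemarieRieusset2002,
RobinsonRodrigoSadowski2016] -/
@[route_item "route-NavierStokesRegularity-AdiabaticEddy"]
def ClayUniqueness : Prop :=
  ∀ ν : ℝ, 0 < ν → ∀ (u₀ : EuclideanSpace ℝ (Fin 3) → EuclideanSpace ℝ (Fin 3)), Literature.Analysis.FluidPDE.HasRapidSpatialDecay u₀ → ∀ (u v : ℝ → EuclideanSpace ℝ (Fin 3) → EuclideanSpace ℝ (Fin 3)) (p q : ℝ → EuclideanSpace ℝ (Fin 3) → ℝ) (T : ℝ), 0 < T → Literature.Analysis.FluidPDE.IsSmoothOnHalfSpace u → Literature.Analysis.FluidPDE.IsSmoothOnHalfSpace p → Literature.Analysis.FluidPDE.IsNavierStokesSolution ν 0 u₀ u p → Literature.Analysis.FluidPDE.HasBoundedEnergy u → Literature.Analysis.FluidPDE.IsClassicalNSSolutionOn (Set.Ico 0 T) ν 0 v q → Literature.Analysis.FluidPDE.IsLerayHopfOn T ν 0 u₀ v → v 0 = u₀ → ∀ t ∈ Set.Ico 0 T, u t = v t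

-- earlier ChiralEddyExists (stmt-NavierStokesRegularity-1432, replaced 2026-08-15T16:14:31Z -> stmt-NavierStokesRegularity-10397): retired by None — ∃ (U : EuclideanSpace ℝ (Fin 3) → EuclideanSpace ℝ (Fin 3)) (P : EuclideanSpace ℝ (Fin 3) → ℝ), ContDiff ℝ (⊤ : ℕ∞) U ∧ ContDiff ℝ (⊤ : ℕ∞) P ∧ HasCompactSupport U ∧ Literature.Analysis.FluidPDE.VectorCalculus.IsDivFree U ∧ (∀ x, Literature.Analysis.Flu
/-- item stmt-NavierStokesRegularity-10397 · support · rank 9 · closed · moot by None · by planner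
sources: arXiv:1810.08020, arXiv:1903.11699, arXiv:1407.7303
[support] MOMENT CONDITIONS OF CLASS (III-c) ARE REALISABLE (card A3, downgraded by the planner from
crux to support; restated 2026-08-15 by the route-repair planner with `helicity U` UNFOLDED to its
definiens ∫⟪U, curl U⟫ — definitionally the same statement (Iff.rfl checked on the farm), so that
the route file no longer imports Literature.Analysis.FluidPDE.Vorticity and its unproved fact
IsVorticitySolutionOn.exists_pressure leaves the cone): there is a smooth compactly supported steady
Euler flow U (∃P, U·∇U + ∇P = 0, div U = 0) with helicity h = ∫U·curl U ≠ 0, ANTI-SUPERHELICAL sign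
(∫curl U·curl curl U)·h < 0 (i.e. η = d_H/h < 0: viscosity raises |H|/E), and zero angular momentum
∫ y × U(y) dy = 0 (Lean: Literature.Analysis.FluidPDE.curl, cross; Bochner integrals, junk value 0
if non-integrable — U is smooth compactly supported so all integrands are integrable). Impulse needs
no clause: ½∫y×curl U = ∫U = 0 for every compactly supported div-free U. Expected proof (planner's
four-blob trick): take any compactly supported steady Euler flow G with h(G)·d_H(G) ≠ 0 (Gavrilov
arXiv:1810.08020 / Constantin–La–Vicol arXiv:1903.11699 swirling tori: helical streamlines on nested
tori, h ≠ -/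
@[route_item "route-NavierStokesRegularity-AdiabaticEddy"]
def ChiralEddyExists : Prop :=
  ∃ (U : EuclideanSpace ℝ (Fin 3) → EuclideanSpace ℝ (Fin 3)) (P : EuclideanSpace ℝ (Fin 3) → ℝ), ContDiff ℝ (⊤ : ℕ∞) U ∧ ContDiff ℝ (⊤ : ℕ∞) P ∧ HasCompactSupport U ∧ Literature.Analysis.FluidPDE.VectorCalculus.IsDivFree U ∧ (∀ x, Literature.Analysis.FluidPDE.convect U U x + gradient P x = 0) ∧ (∫ x, inner ℝ (U x) (Literature.Analysis.FluidPDE.curl U x)) ≠ 0 ∧ (∫ x, inner ℝ (Literature.Analysis.FluidPDE.curl U x) (Literature.Analysis.FluidPDE.curl (Literature.Analysis.FluidPDE.curl U) x)) * (∫ x, inner ℝ (U x) (Literature.Analysis.FluidPDE.curl U x)) < 0 ∧ (∫ x, Literature.Analysis.FluidPDE.cross x (U x)) = 0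

-- earlier Assembly (stmt-NavierStokesRegularity-10398, replaced 2026-08-15T16:16:05Z -> stmt-NavierStokesRegularity-10454): retired by None — FrozenEddyCollapse → ClayUniqueness → ¬ NavierStokesRegularity
-- earlier Assembly (stmt-NavierStokesRegularity-1428, replaced 2026-08-15T16:14:31Z -> stmt-NavierStokesRegularity-10398): retired by None — (∃ ν : ℝ, 0 < ν ∧ ∃ T : ℝ, 0 < T ∧ ∃ (u : ℝ → EuclideanSpace ℝ (Fin 3) → EuclideanSpace ℝ (Fin 3)) (p : ℝ → EuclideanSpace ℝ (Fin 3) → ℝ), Literature.Analysis.FluidPDE.IsMaximalSmoothSolution ν 0 u p T ∧ Literature.Analysis.FluidPDE.IsLerayHopfOn T ν 0 (u 0) u 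
/-- item stmt-NavierStokesRegularity-10454 · assembly · rank 1 · closed · proved by Summit.NavierStokesRegularity.NavierStokesRegularity.Theorems.adiabaticEddy_assembly_proof @ df3faa7aaeed (prover) · by planner
sources: Fefferman2000, BealeKatoMajda1984
[assembly] FrozenEddyCollapse → ClayUniqueness → ¬NavierStokesRegularity, now stated BY NAME over
the route's own decls (restated 2026-08-15 by the route-repair planner, rev 3 spelling `¬
_root_.NavierStokesRegularity` = the deciding theorem's literal conclusion; the rev-2 → rev-3
restatement only sheds the inherited Theorems.BlowupAssembly import: the rev-1 text inlined both
bodies, which the glue lint read as extra hypotheses, and carried the Theorems.BlowupAssembly import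
that dragged NSLerayHopf/NSWave0 into the cone). It is exactly the content of the route's deciding
theorem `closes` (D-0027 §2.1; proof: project FrozenEddyCollapse to X5a = maximal smooth Leray–Hopf
solution with finite lifespan from a rapidly decaying datum, apply Clay (A) to the datum, glue by
ClayUniqueness on [0,T), read the wave-0 solution as a classical solution on Ici 0 field by field,
restrict to Ico 0 (T+1), contradict maximality — Beale–Kato–Majda 1984 §1), so a prover closes this
item with `fun hX hU => closes hX hU`. [sources: Fefferman2000, BealeKatoMajda1984] -/
@[route_item "route-NavierStokesRegularity-AdiabaticEddy"]
def Assembly : Prop :=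
  FrozenEddyCollapse → ClayUniqueness → ¬ _root_.NavierStokesRegularity

end Summit.NavierStokesRegularity.NavierStokesRegularity.Theses.AdiabaticEddy
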